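import Literature.Analysis.PDE.LoewnerNirenbergFacts
import Mathlib.Geometry.Euclidean.Inversion.Calculus
import HarnessLib

/-!
# The Kelvin identity: proof of F4 (discharge of `isSolution_kelvinTransform`)

Analysis/PDE proof file, named for its result (the Kelvin identity / conformal invariance of the
Loewner–Nirenberg equation); sibling of `LoewnerNirenbergFacts` (the named fact
`Literature.Analysis.PDE.LoewnerNirenberg.isSolution_kelvinTransform`, F4 there: for `n ≥ 3`,
`Ω ⊆ ℝⁿ` open, `a ∉ Ω`, `r > 0` and `u` a nonnegative classical solution of
`Δu = ¼n(n-2)u^{(n+2)/(n-2)}` on `Ω`, the Kelvin transform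
`(K u)(y) = ((r/|y-a|)²)^{(n-2)/2} u(ι_{a,r} y)` is a solution on `ι_{a,r}(Ω)`
[GonzalezLiNguyen2018, §2.2 (LoewnerNirenberg1974)]). This file PROVES it:
`isSolution_kelvinTransform_holds`, and records the consequences `IsSolution.kelvinTransform` (the
Kelvin correspondence of solutions, unconditionally) and
`loewnerNirenberg_inversion_of_exists_isMaximalSolution` (LN2, the Möbius covariance
`u_{ι(Ω)}(ι x) · ((r/|x-a|)²)^{(n-2)/2} = u_Ω(x)`, now under F1 alone). (It is kept apart from
`LoewnerNirenbergFactsProofs`, which other discharges of the same fact file resubmit whole.)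

The source (M. d. M. González, Y. Y. Li, L. Nguyen, *Existence and uniqueness to a fully nonlinear
version of the Loewner–Nirenberg problem*, Commun. Math. Stat. 6 (2018), arXiv:1804.08851, held:
paper:arxiv-1804.08851, §2.2 = the proof of the local Lipschitz lemma, read) only says, for
`u_{x,λ}(y) = (λ/|y-x|)^{n-2} u(x + λ²(y-x)/|y-x|²)`, "By conformal invariance,
`f(λ(-A^{u_{x,λ}})) = 1`". The content is the classical KELVIN IDENTITY
`Δ(K u)(y) = ((r/|y-a|)²)^{(n+2)/2} (Δu)(ι_{a,r} y)` (W. Thomson 1847), which we establish by the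
direct computation, on Mathlib's Laplacian `Δ = Laplacian.laplacian` of a finite-dimensional real
inner product space `E`, `n = finrank ℝ E`:

## The argument (as formalised)

* `laplacian_eq_sum_fderiv_fderiv_apply`: `ΔG(x) = Σ_i ∂_{e_i}(∂_{e_i}G)(x)` along an orthonormal
  basis, whenever `DG` is differentiable at `x` (all second derivatives below are computed as first
  derivatives of directional derivatives).
* **Leibniz rule** `laplacian_smul_apply`: `Δ(f • g) = Δf • g + 2 Σ_i (∂_i f) • (∂_i g) + f • Δg`
  for `f` scalar, `g` vector valued, both `C²` AT THE POINT (the tree's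
  `Literature.Analysis.FluidPDE.laplacian_mul_eq` asks global `ContDiff ℝ 2`, which neither the
  weight `‖y-a‖^{2-n}` (singular at the pole) nor `u` (only `C²` on `Ω`) satisfies).
* **Chain rule** `laplacian_comp_apply`: `Δ(v ∘ φ)(x) = Σ_i D²v(φx)(Dφ e_i, Dφ e_i) + Dv(φx)(Δφ(x))`
  for `φ : E → E` `C²` at `x`, `v` `C²` at `φ x`; and `sum_fderiv_fderiv_conformal`: if
  `Dφ(x) = c • R` with `R` a linear isometry, the second-order term is `c² (Δv)(φ x)`.
* **The inversion** `ι₀ = inversion 0 r`, `ι₀ z = (r²/‖z‖²) z`: Mathlib's `hasFDerivAt_inversion`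
  gives `Dι₀(z) = (r/‖z‖)² • R_z`, `R_z` the reflection in `z^⊥` (`R_z z = -z`), and
  `laplacian_inversion_zero`: `Δι₀(z) = -2(n-2) r² ‖z‖⁻⁴ z` (Leibniz rule with `g = id` and the
  radial calculus of `Literature.Analysis.FluidPDE.RadialCalculus` for `r²/‖z‖²`).
* **The Kelvin identity** `laplacian_kelvin_zero`: for `z ≠ 0`, `2k = n - 2`, `v` `C²` at `ι₀ z`,
  `Δ(y ↦ ((r/‖y‖)²)^k v(ι₀ y))(z) = ((r/‖z‖)²)^{k+2} (Δv)(ι₀ z)`: the weight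
  `((r/‖y‖)²)^k = r^{2k}‖y‖^{-2k}` is harmonic exactly when `2k = n - 2`, the cross term is
  `2 Σ_i (∂_i w)(∂_i (v ∘ ι₀)) = 4k w (r²/‖z‖⁴) Dv(ι₀z)(z)`, and the chain rule contributes
  `w (r/‖z‖)⁴ (Δv)(ι₀ z) + w Dv(ι₀ z)(Δι₀ z)`
  `= w (r/‖z‖)⁴ (Δv)(ι₀ z) - 2(n-2) w (r²/‖z‖⁴) Dv(ι₀z)(z)`;
  the first-order terms cancel since `4k = 2(n-2)`.
* **F4** `isSolution_kelvinTransform_holds`: translate the pole to `0`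
  (`inversion a r y = inversion 0 r (y - a) + a`, `laplacian_translate_sub/add`), apply the Kelvin
  identity to `v = u(· + a)`, and use `((r/|y-a|)²)^{k+2} f_n(t) = f_n(((r/|y-a|)²)^k t)`
  (`k (n+2)/(n-2) = k + 2` for `n ≥ 3`); `K u` is `C²` on `ι(Ω)` by `ContDiffAt.inversion` and
  `ContDiffAt.rpow_const_of_ne`, and nonnegative.

## References

* M. d. M. González, Y. Y. Li, L. Nguyen, Commun. Math. Stat. 6 (2018) 269–288, arXiv:1804.08851:
  §2.2 ("By conformal invariance"). [GonzalezLiNguyen2018]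
* C. Loewner, L. Nirenberg, *Partial differential equations invariant under conformal or projective
  transformations*, Contributions to Analysis (1974), 245–272 (the invariance of the equation under
  Möbius transformations; title result). [LoewnerNirenberg1974]
-/

noncomputable section

open Set Filter Metric Module
open scoped Laplacian Topology ContDiff RealInnerProductSpace

namespace Literature.Analysis.PDE

namespace LoewnerNirenberg

variable {E : Type*} [NormedAddCommGroup E] [InnerProductSpace ℝ E] [FiniteDimensional ℝ E]

section KelvinCalculus

variable {F : Type*} [NormedAddCommGroup F] [NormedSpace ℝ F]

omit [FiniteDimensional ℝ E] in
/-- `D²G(x)(h)(k) = D(y ↦ DG(y) k)(x) h` when `DG` is differentiable at `x`. [folklore] -/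
theorem fderiv_fderiv_apply_eq_fderiv_apply {G : E → F} {x : E}
    (hG : DifferentiableAt ℝ (fderiv ℝ G) x) (h k : E) :
    fderiv ℝ (fderiv ℝ G) x h k = fderiv ℝ (fun y => fderiv ℝ G y k) x h := by
  rw [fderiv_clm_apply hG (differentiableAt_const k)]
  simp

/-- The Laplacian as the sum of the derivatives of the directional derivatives along an
orthonormal basis: `ΔG(x) = Σ_i ∂_{e_i}(∂_{e_i} G)(x)`. [folklore] -/
theorem laplacian_eq_sum_fderiv_fderiv_apply {G : E → F} {x : E}
    (hG : DifferentiableAt ℝ (fderiv ℝ G) x) {ι : Type*} [Fintype ι] (b : OrthonormalBasis ι ℝ E) :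
    (Δ G) x = ∑ i, fderiv ℝ (fun y => fderiv ℝ G y (b i)) x (b i) := by
  rw [congrFun (InnerProductSpace.laplacian_eq_iteratedFDeriv_orthonormalBasis G b) x]
  refine Finset.sum_congr rfl fun i _ => ?_
  rw [iteratedFDeriv_two_apply, fderiv_fderiv_apply_eq_fderiv_apply hG]
  simp

omit [InnerProductSpace ℝ E] [FiniteDimensional ℝ E] in
/-- A `C²` function is differentiable near the point. [folklore] -/
theorem eventually_differentiableAt_of_contDiffAt [NormedSpace ℝ E] {G : E → F} {x : E}
    (hG : ContDiffAt ℝ 2 G x) : ∀ᶠ y in 𝓝 x, DifferentiableAt ℝ G y :=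
  (hG.eventually (by simp)).mono fun _ hy => hy.differentiableAt (by simp)

omit [InnerProductSpace ℝ E] [FiniteDimensional ℝ E] in
/-- The derivative of a `C²` function is differentiable at the point. [folklore] -/
theorem differentiableAt_fderiv_of_contDiffAt [NormedSpace ℝ E] {G : E → F} {x : E}
    (hG : ContDiffAt ℝ 2 G x) : DifferentiableAt ℝ (fderiv ℝ G) x :=
  (hG.fderiv_right (m := 1) (by norm_num)).differentiableAt (by simp)

/-- **Leibniz rule for the Laplacian**: for `f` scalar and `g` vector valued, both `C²` at `x`,
`Δ(f • g)(x) = Δf(x) • g(x) + 2 Σ_i (∂_{e_i} f)(x) • (∂_{e_i} g)(x) + f(x) • Δg(x)`. [folklore] -/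
theorem laplacian_smul_apply {f : E → ℝ} {g : E → F} {x : E} (hf : ContDiffAt ℝ 2 f x)
    (hg : ContDiffAt ℝ 2 g x) {ι : Type*} [Fintype ι] (b : OrthonormalBasis ι ℝ E) :
    (Δ (fun y => f y • g y)) x =
      (Δ f) x • g x + (2 : ℝ) • ∑ i, (fderiv ℝ f x (b i)) • (fderiv ℝ g x (b i)) +
        f x • (Δ g) x := by
  have hf1 := eventually_differentiableAt_of_contDiffAt hf
  have hg1 := eventually_differentiableAt_of_contDiffAt hg
  have hf2 := differentiableAt_fderiv_of_contDiffAt hf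
  have hg2 := differentiableAt_fderiv_of_contDiffAt hg
  have hfg2 : DifferentiableAt ℝ (fderiv ℝ (fun y => f y • g y)) x :=
    differentiableAt_fderiv_of_contDiffAt (hf.smul hg)
  rw [laplacian_eq_sum_fderiv_fderiv_apply hfg2 b, laplacian_eq_sum_fderiv_fderiv_apply hf2 b,
    laplacian_eq_sum_fderiv_fderiv_apply hg2 b, Finset.sum_smul, Finset.smul_sum, Finset.smul_sum,
    ← Finset.sum_add_distrib, ← Finset.sum_add_distrib]
  refine Finset.sum_congr rfl fun i _ => ?_
  set e := b i
  -- near `x`, `∂ₑ(f • g) = f • ∂ₑ g + (∂ₑ f) • g`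
  have heq : (fun y => fderiv ℝ (fun y => f y • g y) y e) =ᶠ[𝓝 x]
      fun y => f y • fderiv ℝ g y e + fderiv ℝ f y e • g y := by
    filter_upwards [hf1, hg1] with y hfy hgy
    rw [fderiv_fun_smul hfy hgy]
    simp
  rw [heq.fderiv_eq]
  have hA : HasFDerivAt (fun y => f y • fderiv ℝ g y e)
      (f x • fderiv ℝ (fun y => fderiv ℝ g y e) x +
        (fderiv ℝ f x).smulRight (fderiv ℝ g x e)) x :=
    hf1.self_of_nhds.hasFDerivAt.smul (hg2.clm_apply (differentiableAt_const e)).hasFDerivAt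
  have hB : HasFDerivAt (fun y => fderiv ℝ f y e • g y)
      (fderiv ℝ f x e • fderiv ℝ g x + (fderiv ℝ (fun y => fderiv ℝ f y e) x).smulRight (g x)) x :=
    (hf2.clm_apply (differentiableAt_const e)).hasFDerivAt.smul hg1.self_of_nhds.hasFDerivAt
  rw [(hA.fun_add hB).fderiv]
  simp only [add_apply, smul_apply, ContinuousLinearMap.smulRight_apply, two_smul]
  abel

/-- **Chain rule for the Laplacian**: for `φ : E → E` `C²` at `x` and `v` `C²` at `φ x`,
`Δ(v ∘ φ)(x) = Σ_i D²v(φ x)(Dφ(x) e_i, Dφ(x) e_i) + Dv(φ x)(Δφ(x))`. [folklore] -/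
theorem laplacian_comp_apply {φ : E → E} {v : E → F} {x : E} (hφ : ContDiffAt ℝ 2 φ x)
    (hv : ContDiffAt ℝ 2 v (φ x)) {ι : Type*} [Fintype ι] (b : OrthonormalBasis ι ℝ E) :
    (Δ (fun y => v (φ y))) x =
      ∑ i, fderiv ℝ (fderiv ℝ v) (φ x) (fderiv ℝ φ x (b i)) (fderiv ℝ φ x (b i)) +
        fderiv ℝ v (φ x) ((Δ φ) x) := by
  have hφ1 := eventually_differentiableAt_of_contDiffAt hφ
  have hv1 : ∀ᶠ y in 𝓝 x, DifferentiableAt ℝ v (φ y) :=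
    hφ.continuousAt.eventually (eventually_differentiableAt_of_contDiffAt hv)
  have hφ2 := differentiableAt_fderiv_of_contDiffAt hφ
  have hv2 := differentiableAt_fderiv_of_contDiffAt hv
  have hc2 : DifferentiableAt ℝ (fderiv ℝ (fun y => v (φ y))) x :=
    differentiableAt_fderiv_of_contDiffAt (hv.comp x hφ)
  rw [laplacian_eq_sum_fderiv_fderiv_apply hc2 b, laplacian_eq_sum_fderiv_fderiv_apply hφ2 b,
    map_sum, ← Finset.sum_add_distrib]
  refine Finset.sum_congr rfl fun i _ => ?_
  set e := b i
  have heq : (fun y => fderiv ℝ (fun y => v (φ y)) y e) =ᶠ[𝓝 x]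
      fun y => fderiv ℝ v (φ y) (fderiv ℝ φ y e) := by
    filter_upwards [hφ1, hv1] with y hφy hvy
    rw [fderiv_fun_comp y hvy hφy]
    rfl
  rw [heq.fderiv_eq]
  have hc : HasFDerivAt (fun y => fderiv ℝ v (φ y))
      ((fderiv ℝ (fderiv ℝ v) (φ x)).comp (fderiv ℝ φ x)) x :=
    hv2.hasFDerivAt.comp x hφ1.self_of_nhds.hasFDerivAt
  have hu : HasFDerivAt (fun y => fderiv ℝ φ y e)
      (fderiv ℝ (fun y => fderiv ℝ φ y e) x) x :=
    (hφ2.clm_apply (differentiableAt_const e)).hasFDerivAt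
  rw [(hc.clm_apply hu).fderiv]
  simp only [add_apply, ContinuousLinearMap.comp_apply, ContinuousLinearMap.flip_apply]
  rw [add_comm]

/-- The second-order term of the chain rule for a CONFORMAL linear part `L = c • R`, `R` a linear
isometry: `Σ_i D²v(y)(L e_i, L e_i) = c² Δv(y)`. [folklore] -/
theorem sum_fderiv_fderiv_conformal (v : E → F) (y : E) (R : E ≃ₗᵢ[ℝ] E) (c : ℝ) {ι : Type*}
    [Fintype ι] (b : OrthonormalBasis ι ℝ E) :
    ∑ i, fderiv ℝ (fderiv ℝ v) y ((c • (R : E →L[ℝ] E)) (b i)) ((c • (R : E →L[ℝ] E)) (b i)) =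
      c ^ 2 • (Δ v) y := by
  rw [congrFun (InnerProductSpace.laplacian_eq_iteratedFDeriv_orthonormalBasis v (b.map R)) y,
    Finset.smul_sum]
  refine Finset.sum_congr rfl fun i _ => ?_
  rw [iteratedFDeriv_two_apply]
  simp only [smul_apply, map_smul, OrthonormalBasis.map_apply, Matrix.cons_val_zero,
    Matrix.cons_val_one, smul_smul, sq]
  rfl

/-- The Laplacian of the identity map vanishes. [folklore] -/
theorem laplacian_fun_id (x : E) : (Δ (fun y : E => y)) x = 0 := by
  have hD : fderiv ℝ (fun y : E => y) = fun _ => ContinuousLinearMap.id ℝ E := by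
    funext y
    exact fderiv_id
  rw [laplacian_eq_sum_fderiv_fderiv_apply (by rw [hD]; exact differentiableAt_const _)
    (stdOrthonormalBasis ℝ E)]
  simp

omit [FiniteDimensional ℝ E] in
/-- `Σ_i ⟨z, e_i⟩ e_i = z` for an orthonormal basis. [folklore] -/
theorem sum_inner_smul_eq {ι : Type*} [Fintype ι] (b : OrthonormalBasis ι ℝ E) (z : E) :
    ∑ i, ⟪z, b i⟫ • b i = z := by
  conv_rhs => rw [← b.sum_repr' z]
  exact Finset.sum_congr rfl fun i _ => by rw [real_inner_comm]

/-- `d/dσ σ^p = p σ^{p-1}` for `σ > 0`, with the exponent `q = p - 1` of the derivative as a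
separate argument (to ease rewriting). [folklore] -/
theorem hasDerivAt_rpow_const_of_pos (p q : ℝ) (hq : q = p - 1) {σ : ℝ} (hσ : 0 < σ) :
    HasDerivAt (fun τ : ℝ => τ ^ p) (p * σ ^ q) σ := by
  subst hq
  exact Real.hasDerivAt_rpow_const (Or.inl hσ.ne')

omit [FiniteDimensional ℝ E] in
/-- The inversion with pole `0` and radius `r`: `ι₀ y = (r² (‖y‖²)^{-1}) • y`. [folklore] -/
theorem inversion_zero_eq_smul (r : ℝ) (y : E) :
    EuclideanGeometry.inversion (0 : E) r y = (r ^ 2 * (‖y‖ ^ 2) ^ (-1 : ℝ)) • y := by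
  rw [EuclideanGeometry.inversion, Real.rpow_neg_one, dist_zero_right, div_pow, div_eq_mul_inv]
  simp

/-- **The Laplacian of the inversion** (pole `0`, radius `r`) at `z ≠ 0`:
`Δι₀(z) = -2(n-2) r² ‖z‖⁻⁴ z` (`ι₀ = c • id` with `c = r²/‖·‖²`: `Δι₀ = Δc • z + 2∇c`,
`Δ(‖z‖^{-2}) = (8 - 2n)‖z‖^{-4}`, `∇(‖z‖^{-2}) = -2‖z‖^{-4} z`). [folklore] -/
theorem laplacian_inversion_zero (r : ℝ) {z : E} (hz : z ≠ 0) :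
    (Δ (EuclideanGeometry.inversion (0 : E) r)) z =
      (-(2 * ((finrank ℝ E : ℝ) - 2)) * r ^ 2 / (‖z‖ ^ 2) ^ 2) • z := by
  set b := stdOrthonormalBasis ℝ E
  have hs : 0 < ‖z‖ ^ 2 := by positivity
  have hι : (EuclideanGeometry.inversion (0 : E) r : E → E) =
      fun y => (r ^ 2 * (‖y‖ ^ 2) ^ (-1 : ℝ)) • y := funext (inversion_zero_eq_smul r)
  -- derivative data of the radial coefficient `c(σ) = r² σ⁻¹`
  have hgd : ∀ σ ∈ Ioi (0 : ℝ),
      HasDerivAt (fun τ : ℝ => r ^ 2 * τ ^ (-1 : ℝ)) (-r ^ 2 * σ ^ (-2 : ℝ)) σ := fun σ hσ =>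
    (((hasDerivAt_rpow_const_of_pos (-1) (-2) (by norm_num) hσ).const_mul (r ^ 2)).congr_deriv
      (by ring))
  have hg₁d : HasDerivAt (fun σ : ℝ => -r ^ 2 * σ ^ (-2 : ℝ)) (2 * r ^ 2 * (‖z‖ ^ 2) ^ (-3 : ℝ))
      (‖z‖ ^ 2) :=
    ((hasDerivAt_rpow_const_of_pos (-2) (-3) (by norm_num) hs).const_mul (-r ^ 2)).congr_deriv
      (by ring)
  have hc2 : ContDiffAt ℝ 2 (fun y : E => r ^ 2 * (‖y‖ ^ 2) ^ (-1 : ℝ)) z :=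
    contDiffAt_const.mul ((contDiff_norm_sq ℝ).contDiffAt.rpow_const_of_ne hs.ne')
  rw [hι, laplacian_smul_apply (g := fun y : E => y) hc2 contDiffAt_id b, laplacian_fun_id,
    smul_zero, add_zero,
    Literature.Analysis.FluidPDE.laplacian_comp_norm_sq (E := E) isOpen_Ioi hgd hs hg₁d]
  have hD : ∀ i, fderiv ℝ (fun y : E => r ^ 2 * (‖y‖ ^ 2) ^ (-1 : ℝ)) z (b i) =
      2 * (-r ^ 2 * (‖z‖ ^ 2) ^ (-2 : ℝ)) * ⟪z, b i⟫ := fun i =>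
    Literature.Analysis.FluidPDE.fderiv_comp_norm_sq_apply (hgd _ hs) (b i)
  simp only [hD, fderiv_fun_id, ContinuousLinearMap.id_apply]
  have hsum : ∑ i, (2 * (-r ^ 2 * (‖z‖ ^ 2) ^ (-2 : ℝ)) * ⟪z, b i⟫) • b i =
      (2 * (-r ^ 2 * (‖z‖ ^ 2) ^ (-2 : ℝ))) • z :=
    calc ∑ i, (2 * (-r ^ 2 * (‖z‖ ^ 2) ^ (-2 : ℝ)) * ⟪z, b i⟫) • b i
        = ∑ i, (2 * (-r ^ 2 * (‖z‖ ^ 2) ^ (-2 : ℝ))) • (⟪z, b i⟫ • b i) :=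
          Finset.sum_congr rfl fun i _ => by rw [smul_smul]
      _ = (2 * (-r ^ 2 * (‖z‖ ^ 2) ^ (-2 : ℝ))) • z := by
          rw [← Finset.smul_sum, sum_inner_smul_eq]
  rw [hsum, smul_smul, ← add_smul]
  congr 1
  rw [show (-3 : ℝ) = -((3 : ℕ) : ℝ) by norm_num, show (-2 : ℝ) = -((2 : ℕ) : ℝ) by norm_num,
    Real.rpow_neg hs.le, Real.rpow_neg hs.le, Real.rpow_natCast, Real.rpow_natCast]
  field_simp
  ring

open EuclideanGeometry in
/-- **The Kelvin identity** (pole `0`, radius `r > 0`): for `z ≠ 0`, `v` of class `C²` at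
`ι₀ z`, and `2k = n - 2`,
`Δ(y ↦ ((r/‖y‖)²)^k v(ι₀ y))(z) = ((r/‖z‖)²)^{k+2} (Δv)(ι₀ z)`
(Kelvin 1847: the weight `‖y‖^{2-n}` is harmonic, `Dι₀(y) = (r/‖y‖)² R_y` with `R_y` the
reflection in `y^⊥`, and the two first-order terms cancel exactly when `2k = n - 2`). [folklore] -/
theorem laplacian_kelvin_zero {r : ℝ} (hr : 0 < r) {k : ℝ} (hk : 2 * k = (finrank ℝ E : ℝ) - 2)
    {v : E → ℝ} {z : E} (hz : z ≠ 0) (hv : ContDiffAt ℝ 2 v (inversion (0 : E) r z)) :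
    (Δ (fun y => ((r / ‖y‖) ^ 2) ^ k * v (inversion (0 : E) r y))) z =
      ((r / ‖z‖) ^ 2) ^ (k + 2) * (Δ v) (inversion (0 : E) r z) := by
  set b := stdOrthonormalBasis ℝ E
  obtain ⟨W, hW⟩ : ∃ W : ℝ, (r ^ 2) ^ k = W := ⟨_, rfl⟩
  have hzn : 0 < ‖z‖ := norm_pos_iff.2 hz
  have hs : 0 < ‖z‖ ^ 2 := pow_pos hzn 2
  -- the weight as the radial function `W (‖y‖²)^{-k}`
  have hw : ∀ y : E, ((r / ‖y‖) ^ 2) ^ k = W * (‖y‖ ^ 2) ^ (-k) := fun y => by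
    rw [div_pow, Real.div_rpow (sq_nonneg _) (sq_nonneg _), Real.rpow_neg (sq_nonneg _), hW,
      div_eq_mul_inv]
  have hF : (fun y => ((r / ‖y‖) ^ 2) ^ k * v (inversion (0 : E) r y)) =
      fun y => (W * (‖y‖ ^ 2) ^ (-k)) • v (inversion (0 : E) r y) := by
    funext y
    rw [hw, smul_eq_mul]
  -- derivative data of `g(σ) = W σ^{-k}`: `g' = -Wk σ^{-k-1}`, `g'' = Wk(k+1) σ^{-k-2}`
  have hgd : ∀ σ ∈ Ioi (0 : ℝ),
      HasDerivAt (fun τ : ℝ => W * τ ^ (-k)) (-(W * k) * σ ^ (-k - 1)) σ := fun σ hσ =>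
    (((hasDerivAt_rpow_const_of_pos (-k) (-k - 1) (by ring) hσ).const_mul W).congr_deriv (by ring))
  have hg₁d : HasDerivAt (fun σ : ℝ => -(W * k) * σ ^ (-k - 1))
      (W * k * (k + 1) * (‖z‖ ^ 2) ^ (-k - 2)) (‖z‖ ^ 2) :=
    ((hasDerivAt_rpow_const_of_pos (-k - 1) (-k - 2) (by ring) hs).const_mul (-(W * k))).congr_deriv
      (by ring)
  -- smoothness of the two factors at `z`
  have hf2 : ContDiffAt ℝ 2 (fun y : E => W * (‖y‖ ^ 2) ^ (-k)) z :=
    contDiffAt_const.mul ((contDiff_norm_sq ℝ).contDiffAt.rpow_const_of_ne hs.ne')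
  have hφ : ContDiffAt ℝ 2 (inversion (0 : E) r) z :=
    contDiffAt_const.inversion contDiffAt_const contDiffAt_id hz
  have hg2 : ContDiffAt ℝ 2 (fun y => v (inversion (0 : E) r y)) z := hv.comp z hφ
  -- the derivative of the inversion is conformal: `Dι₀(z) = c • R`, `R z = -z`
  have hDι' := (hasFDerivAt_inversion (c := (0 : E)) (R := r) hz).fderiv
  simp only [sub_zero, dist_zero_right] at hDι'
  obtain ⟨R, hR⟩ : ∃ R : E ≃ₗᵢ[ℝ] E, (ℝ ∙ z)ᗮ.reflection = R := ⟨_, rfl⟩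
  obtain ⟨c, hc⟩ : ∃ c : ℝ, (r / ‖z‖) ^ 2 = c := ⟨_, rfl⟩
  have hDι : fderiv ℝ (inversion (0 : E) r) z = c • (R : E →L[ℝ] E) := by rw [hDι', hR, hc]
  have hRz : (R : E →L[ℝ] E) z = -z := by
    rw [← hR]
    exact Submodule.reflection_orthogonalComplement_singleton_eq_neg z
  have hcs : c = r ^ 2 / ‖z‖ ^ 2 := by rw [← hc, div_pow]
  -- first derivatives of the two factors along the basis
  have hDf : ∀ i, fderiv ℝ (fun y : E => W * (‖y‖ ^ 2) ^ (-k)) z (b i) =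
      2 * (-(W * k) * (‖z‖ ^ 2) ^ (-k - 1)) * ⟪z, b i⟫ := fun i =>
    Literature.Analysis.FluidPDE.fderiv_comp_norm_sq_apply (hgd _ hs) (b i)
  have hDg : ∀ i, fderiv ℝ (fun y => v (inversion (0 : E) r y)) z (b i) =
      c * fderiv ℝ v (inversion (0 : E) r z) ((R : E →L[ℝ] E) (b i)) := fun i => by
    rw [fderiv_fun_comp z (hv.differentiableAt (by simp)) (hφ.differentiableAt (by simp)), hDι]
    simp only [ContinuousLinearMap.comp_apply, smul_apply, map_smul, smul_eq_mul]
  -- the cross term: `Σ_i (∂_i f)(∂_i g) = 2 g'(s) c Dv(R z) = -2 g'(s) c Dv(z)`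
  have hlin : fderiv ℝ v (inversion (0 : E) r z) ((R : E →L[ℝ] E) (∑ i, ⟪z, b i⟫ • b i)) =
      ∑ i, ⟪z, b i⟫ * fderiv ℝ v (inversion (0 : E) r z) ((R : E →L[ℝ] E) (b i)) := by
    rw [map_sum, map_sum]
    exact Finset.sum_congr rfl fun i _ => by rw [map_smul, map_smul, smul_eq_mul]
  rw [sum_inner_smul_eq b z, hRz, map_neg] at hlin
  have hcross : ∑ i, fderiv ℝ (fun y : E => W * (‖y‖ ^ 2) ^ (-k)) z (b i) •
      fderiv ℝ (fun y => v (inversion (0 : E) r y)) z (b i) =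
        -(2 * (-(W * k) * (‖z‖ ^ 2) ^ (-k - 1)) * c *
          fderiv ℝ v (inversion (0 : E) r z) z) := by
    simp only [hDf, hDg, smul_eq_mul]
    calc ∑ i, 2 * (-(W * k) * (‖z‖ ^ 2) ^ (-k - 1)) * ⟪z, b i⟫ *
          (c * fderiv ℝ v (inversion (0 : E) r z) ((R : E →L[ℝ] E) (b i)))
        = 2 * (-(W * k) * (‖z‖ ^ 2) ^ (-k - 1)) * c *
            ∑ i, ⟪z, b i⟫ * fderiv ℝ v (inversion (0 : E) r z) ((R : E →L[ℝ] E) (b i)) := by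
          rw [Finset.mul_sum]
          exact Finset.sum_congr rfl fun i _ => by ring
      _ = _ := by rw [← hlin]; ring
  -- the second-order term: `Δ(v ∘ ι₀) = c² Δv ∘ ι₀ + Dv(Δι₀)`
  have hΔg : (Δ (fun y => v (inversion (0 : E) r y))) z =
      c ^ 2 * (Δ v) (inversion (0 : E) r z) +
        (-(2 * ((finrank ℝ E : ℝ) - 2)) * r ^ 2 / (‖z‖ ^ 2) ^ 2) *
          fderiv ℝ v (inversion (0 : E) r z) z := by
    rw [laplacian_comp_apply hφ hv b, hDι, sum_fderiv_fderiv_conformal v _ R c b,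
      laplacian_inversion_zero r hz, map_smul, smul_eq_mul, smul_eq_mul]
  -- assemble
  rw [hF, laplacian_smul_apply hf2 hg2 b, hcross, hΔg,
    Literature.Analysis.FluidPDE.laplacian_comp_norm_sq (E := E) isOpen_Ioi hgd hs hg₁d]
  simp only [smul_eq_mul]
  have h1 : (‖z‖ ^ 2) ^ (-k - 1) = (‖z‖ ^ 2) ^ (-k) / ‖z‖ ^ 2 := by
    rw [Real.rpow_sub hs, Real.rpow_one]
  have h2 : (‖z‖ ^ 2) ^ (-k - 2) = (‖z‖ ^ 2) ^ (-k) / (‖z‖ ^ 2) ^ 2 := by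
    rw [Real.rpow_sub hs, Real.rpow_two]
  have h3 : ((r / ‖z‖) ^ 2) ^ (k + 2) = W * (‖z‖ ^ 2) ^ (-k) * (r ^ 2 / ‖z‖ ^ 2) ^ 2 := by
    rw [Real.rpow_add (pow_pos (div_pos hr hzn) 2), hw, Real.rpow_two, div_pow]
  have hn : (finrank ℝ E : ℝ) = 2 * k + 2 := by linarith
  rw [h1, h2, h3, hcs, hn]
  field_simp
  ring

end KelvinCalculus

section KelvinDischarge

open EuclideanGeometry

variable {F : Type*} [NormedAddCommGroup F] [NormedSpace ℝ F]

omit [InnerProductSpace ℝ E] [FiniteDimensional ℝ E] in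
/-- The inversion with pole `a` is the conjugate by the translation `y ↦ y - a` of the inversion
with pole `0`. [folklore] -/
theorem inversion_eq_inversion_zero_sub_add [InnerProductSpace ℝ E] (a : E) (r : ℝ) (y : E) :
    inversion a r y = inversion (0 : E) r (y - a) + a := by
  simp [inversion, dist_eq_norm]

/-- Translation invariance of the Laplacian, `Δ(f(· + a))(x) = (Δf)(x + a)`. [folklore] -/
theorem laplacian_translate_add (f : E → F) (a x : E) :
    (Δ (fun y => f (y + a))) x = (Δ f) (x + a) := by
  have h := laplacian_translate_sub f (-a) x
  simp only [sub_neg_eq_add] at h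
  exact h

/-- **F4 holds: the Kelvin transform of a solution is a solution on the inverted domain**
(González–Li–Nguyen 2018, §2.2, "by conformal invariance": for `u` solving the equation on `Ω`,
`a ∉ Ω`, `r > 0`, `y ↦ (r/|y-a|)^{n-2} u(ι_{a,r} y)` solves it on `ι_{a,r}(Ω)`).  Proof: the Kelvin
identity `Δ(K u)(y) = ((r/|y-a|)²)^{(n+2)/2} (Δu)(ι y)` (`laplacian_kelvin_zero`, after translating
the pole to `0`) and `((r/|y-a|)²)^{(n+2)/2} f_n(t) = f_n(((r/|y-a|)²)^{(n-2)/2} t)`.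
[cite: GonzalezLiNguyen2018, §2.2 (LoewnerNirenberg1974)] -/
theorem isSolution_kelvinTransform_holds : isSolution_kelvinTransform (E := E) := by
  intro Ω u a r hn hr hΩ ha hu
  obtain ⟨k, hk⟩ : ∃ k : ℝ, ((finrank ℝ E : ℝ) - 2) / 2 = k := ⟨_, rfl⟩
  have hk2 : 2 * k = (finrank ℝ E : ℝ) - 2 := by rw [← hk]; ring
  -- `ι` maps `ι(Ω)` back into `Ω`, and `ι(Ω)` avoids the pole
  have hmem : ∀ {y}, y ∈ inversion a r '' Ω → inversion a r y ∈ Ω := by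
    rintro y ⟨x, hx, rfl⟩
    rwa [inversion_inversion a hr.ne']
  have hne : ∀ {y}, y ∈ inversion a r '' Ω → y ≠ a := fun hy h =>
    (notMem_image_inversion hr ha) (h ▸ hy)
  have hKdef : kelvinTransform a r u =
      fun y => ((r / dist y a) ^ 2) ^ k * u (inversion a r y) := by
    funext y
    rw [kelvinTransform, hk]
  refine ⟨?_, ?_, ?_⟩
  · -- `K u` is `C²` on `ι(Ω)`
    rw [hKdef]
    intro y hy
    have hya := hne hy
    have h1 : ContDiffAt ℝ 2 (fun y => (r / dist y a) ^ 2) y :=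
      (contDiffAt_const.div (contDiffAt_id.dist ℝ contDiffAt_const hya) (dist_ne_zero.2 hya)).pow 2
    have h2 : ContDiffAt ℝ 2 (fun y => ((r / dist y a) ^ 2) ^ k) y :=
      h1.rpow_const_of_ne (pow_pos (div_pos hr (dist_pos.2 hya)) 2).ne'
    have h3 : ContDiffAt ℝ 2 (fun y => u (inversion a r y)) y :=
      (hu.contDiffOn.contDiffAt (hΩ.mem_nhds (hmem hy))).comp y
        (contDiffAt_const.inversion contDiffAt_const contDiffAt_id hya)
    exact (h2.mul h3).contDiffWithinAt
  · -- `K u ≥ 0` on `ι(Ω)`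
    intro y hy
    exact mul_nonneg (Real.rpow_nonneg (sq_nonneg _) _) (hu.nonneg (hmem hy))
  · -- the equation at `y ∈ ι(Ω)`
    intro y hy
    have hya := hne hy
    have hιy := hmem hy
    have hz0 : y - a ≠ 0 := sub_ne_zero.2 hya
    have hιz : inversion (0 : E) r (y - a) + a = inversion a r y :=
      (inversion_eq_inversion_zero_sub_add a r y).symm
    -- translate the pole to `0`
    have hK : kelvinTransform a r u = fun y' =>
        (fun w => ((r / ‖w‖) ^ 2) ^ k * u (inversion (0 : E) r w + a)) (y' - a) := by
      funext y'
      rw [kelvinTransform, hk, dist_eq_norm, inversion_eq_inversion_zero_sub_add a r y']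
    have hvC : ContDiffAt ℝ 2 (fun x => u (x + a)) (inversion (0 : E) r (y - a)) := by
      have h : ContDiffAt ℝ 2 u (inversion (0 : E) r (y - a) + a) := by
        rw [hιz]
        exact hu.contDiffOn.contDiffAt (hΩ.mem_nhds hιy)
      exact ContDiffAt.comp (f := fun x => x + a) _ h (contDiffAt_id.add contDiffAt_const)
    have hΔ : (Δ (kelvinTransform a r u)) y =
        ((r / ‖y - a‖) ^ 2) ^ (k + 2) * (Δ u) (inversion a r y) := by
      rw [hK, laplacian_translate_sub (fun w => ((r / ‖w‖) ^ 2) ^ k * u (inversion (0 : E) r w + a))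
        a y, laplacian_kelvin_zero hr hk2 hz0 hvC, laplacian_translate_add u a, hιz]
    rw [hΔ, hu.laplacian_eq hιy, hKdef]
    simp only [dist_eq_norm]
    -- the algebra `μ^{k+2} f(t) = f(μ^k t)` for `μ = (r/|y-a|)² > 0`, `t = u(ι y) ≥ 0`
    obtain ⟨μ, hμ⟩ : ∃ μ : ℝ, (r / ‖y - a‖) ^ 2 = μ := ⟨_, rfl⟩
    have hμ0 : 0 < μ := by rw [← hμ]; exact pow_pos (div_pos hr (norm_pos_iff.2 hz0)) 2
    have ht : 0 ≤ u (inversion a r y) := hu.nonneg hιy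
    rw [hμ]
    simp only [nonlinearity, coeff, exponent]
    have h2 : ((finrank ℝ E : ℕ) : ℝ) - 2 ≠ 0 := by
      have h3 : (3 : ℝ) ≤ (finrank ℝ E : ℕ) := by exact_mod_cast hn
      intro h
      linarith
    have hkp : k * ((((finrank ℝ E : ℕ) : ℝ) + 2) / (((finrank ℝ E : ℕ) : ℝ) - 2)) = k + 2 := by
      rw [← hk]
      field_simp
      ring
    rw [Real.mul_rpow (Real.rpow_nonneg hμ0.le _) ht, ← Real.rpow_mul hμ0.le, hkp]
    ring

end KelvinDischarge

section Consequences

open EuclideanGeometry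

/-- **The Kelvin correspondence of solutions** (F4, discharged; dot-notation form): for `n ≥ 3`,
`Ω` open, `a ∉ Ω`, `r > 0` and `u` a solution of `Δu = ¼n(n-2)u^{(n+2)/(n-2)}` on `Ω`, the Kelvin
transform `y ↦ ((r/|y-a|)²)^{(n-2)/2} u(ι_{a,r} y)` is a solution on `ι_{a,r}(Ω)`
(González–Li–Nguyen 2018, §2.2, "by conformal invariance").
[cite: GonzalezLiNguyen2018, §2.2 (LoewnerNirenberg1974)] -/
theorem IsSolution.kelvinTransform {Ω : Set E} {u : E → ℝ} {a : E} {r : ℝ} (hu : IsSolution Ω u)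
    (hn : 3 ≤ finrank ℝ E) (hr : 0 < r) (hΩ : IsOpen Ω) (ha : a ∉ Ω) :
    IsSolution (inversion a r '' Ω) (kelvinTransform a r u) :=
  isSolution_kelvinTransform_holds hn hr hΩ ha hu

/-- **LN2 — Möbius (inversion) covariance of `u_Ω` under F1 alone**: for `n ≥ 3`, a domain `Ω`
with `ℝⁿ ∖ Ω̄ ≠ ∅` and `ℝⁿ ∖ cl ι(Ω) ≠ ∅`, pole `a ∉ Ω`, radius `r > 0`, and `x ∈ Ω`,
`u_{ι(Ω)}(ι x) · ((r/|x-a|)²)^{(n-2)/2} = u_Ω(x)` (`loewnerNirenberg_inversion` with its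
hypothesis F4 supplied by `isSolution_kelvinTransform_holds`).
[cite: GonzalezLiNguyen2018, §2.2 and Def. 4.1 (LoewnerNirenberg1974)] -/
theorem loewnerNirenberg_inversion_of_exists_isMaximalSolution
    (h1 : exists_isMaximalSolution (E := E)) (hn : 3 ≤ finrank ℝ E) {Ω : Set E} {a : E} {r : ℝ}
    (hΩ : IsOpen Ω) (hconn : IsConnected Ω) (hc : (closure Ω)ᶜ.Nonempty)
    (hc' : (closure (inversion a r '' Ω))ᶜ.Nonempty) (ha : a ∉ Ω) (hr : 0 < r) {x : E}
    (hx : x ∈ Ω) :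
    loewnerNirenberg (inversion a r '' Ω) (inversion a r x) *
        ((r / dist x a) ^ 2) ^ (((finrank ℝ E : ℝ) - 2) / 2) = loewnerNirenberg Ω x :=
  loewnerNirenberg_inversion h1 isSolution_kelvinTransform_holds hn hΩ hconn hc hc' ha hr hx

end Consequences


end LoewnerNirenberg

end Literature.Analysis.PDE
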